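import Summits.CriticalPhenomena.PercolationContinuityZ3.Theorems.PercNearOneGluingNoHeavyLowerTailSahiCTCStrongTwistedKleitman

/-!
# `NoHeavyLowerTail` (crux stmt-CriticalPhenomena-4575), P3 lane: THE SPLICE CHAIN IS MONOTONE IN THE LEVEL

Support file (seat `prim-l12-p3`, gen 36; `--supports stmt-CriticalPhenomena-4575`), companion of
`…SahiCTCStrongTwistedKleitman` (strong twisted Kleitman inequality STK_s).  Memo
`run/shared/lean/prim/prim-l12/FROM-prim-l12-p3-g36-LAST-COORDINATE.md` §1.

With the notation of that file (`x = C ∪ W`, `y = C ∪ (R \ W)`, order-`s` splice `ψ̃_s(x,y)` written out as the union of two rank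
filters), put `N_s := #{W ⊆ R : A x ∧ B (ψ̃_s(x,y))}`.  THEOREM (`card_splice_le_card_splice_succ`): `N_s ≤ N_{s+1}` for every `s`.
Since `ψ̃_0(x,y) = y` and `ψ̃_s(x,y) = x` for `s > #(C ∪ R)`, the chain runs from `#{x ∈ A : y ∈ B}` up to `#{x ∈ A ∩ B}` and contains
STK_s for every `s`; its consecutive differences are sums, over the stopped prefixes with `s` ones, of level-`1` (twisted Kleitman)
instances on the suffix sections.  Proof: the max-coordinate induction of the companion file; the pointwise remainder now sits on
`#x' = s` exactly.  Nothing is asserted about the crux.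
-/

namespace Summit.CriticalPhenomena.PercolationContinuityZ3.Theorems

namespace SahiCTCStrongTwistedKleitman

open Finset

variable {α : Type*} [LinearOrder α]

/-- Below level `s` the splice is `x` itself: `#x < s → ψ̃_s(x,y) = x`. [this work] -/
theorem splice_eq_self_of_card_lt (s : ℕ) {x y : Finset α} (hx : x.card < s) :
    ((x.filter fun v => (x.filter fun w => w ≤ v).card ≤ s) ∪ (y.filter fun v => s ≤ (x.filter fun w => w < v).card)) = x := by
  ext v
  simp only [mem_union, mem_filter]
  constructor
  · rintro (⟨hv, _⟩ | ⟨_, h⟩)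
    · exact hv
    · exact absurd (lt_of_lt_of_le (lt_of_le_of_lt (card_le_card (filter_subset _ x)) hx) h) (lt_irrefl _)
  · intro hv
    exact Or.inl ⟨hv, le_trans (card_le_card (filter_subset _ x)) (le_of_lt hx)⟩

/-- **THE SPLICE CHAIN IS MONOTONE** (memo g36 §1): for monotone predicates `A, B`, disjoint `C, R` and every `s`,
`#{W ⊆ R : A x ∧ B (ψ̃_s(x,y))} ≤ #{W ⊆ R : A x ∧ B (ψ̃_{s+1}(x,y))}` (`x = C ∪ W`, `y = C ∪ (R \ W)`).  So
`N_0 = #{x ∈ A : y ∈ B} ≤ N_1 ≤ N_2 ≤ … ≤ N_s ≤ … ≤ #{x ∈ A ∩ B}`: the strong twisted Kleitman inequality of every level is one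
chain, whose consecutive differences are sums of level-`1` instances over the stopped prefixes.  Proof: the same max-coordinate
induction; the pointwise remainder now sits on `#x' = s` exactly. [this work] -/
theorem card_splice_le_card_splice_succ (s : ℕ) (V : Finset α) :
    ∀ (A B : Finset α → Prop) [DecidablePred A] [DecidablePred B],
      (∀ S T : Finset α, S ⊆ T → A S → A T) → (∀ S T : Finset α, S ⊆ T → B S → B T) →
      ∀ (C R : Finset α), Disjoint C R → C ∪ R = V →
        (R.powerset.filter fun W => A (C ∪ W) ∧
          B (((C ∪ W).filter fun v => ((C ∪ W).filter fun w => w ≤ v).card ≤ s) ∪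
             ((C ∪ (R \ W)).filter fun v => s ≤ ((C ∪ W).filter fun w => w < v).card))).card ≤
        (R.powerset.filter fun W => A (C ∪ W) ∧
          B (((C ∪ W).filter fun v => ((C ∪ W).filter fun w => w ≤ v).card ≤ s + 1) ∪
             ((C ∪ (R \ W)).filter fun v => s + 1 ≤ ((C ∪ W).filter fun w => w < v).card))).card := by
  induction V using Finset.induction_on_max with
  | empty =>
    intro A B _ _ _ _ C R _ hCR
    obtain ⟨rfl, rfl⟩ := union_eq_empty.mp hCR
    apply le_of_eq
    apply congrArg Finset.card
    apply filter_congr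
    intro W hW
    rw [powerset_empty, mem_singleton] at hW
    subst hW
    simp
  | insert n V' hlt ih =>
    intro A B _ _ hA hB C R hdis hCR
    have hnV' : n ∉ V' := fun h => lt_irrefl n (hlt n h)
    have hn : n ∈ C ∪ R := by rw [hCR]; exact mem_insert_self n V'
    rcases mem_union.mp hn with hnC | hnR
    · have hnR : n ∉ R := fun h => disjoint_left.mp hdis hnC h
      set C' := C.erase n with hC'_def
      have hC : C = insert n C' := by rw [hC'_def, insert_erase hnC]
      have hnC' : n ∉ C' := by rw [hC'_def]; exact notMem_erase n C
      have hdis' : Disjoint C' R := disjoint_of_subset_left (erase_subset n C) hdis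
      have hCR' : C' ∪ R = V' := by
        have : (C ∪ R).erase n = (insert n V').erase n := by rw [hCR]
        rwa [erase_insert hnV', hC, insert_union, erase_insert] at this
        rw [mem_union, not_or]; exact ⟨hnC', hnR⟩
      have hsub : ∀ W : Finset α, W ⊆ R → ∀ w ∈ C' ∪ W, w < n := fun W hW w hw => by
        apply hlt; rw [← hCR']; rcases mem_union.mp hw with h | h
        · exact mem_union_left _ h
        · exact mem_union_right _ (hW h)
      have IH := ih (fun S => A (insert n S)) (fun S => B (insert n S))
        (fun S T hST h => hA _ _ (insert_subset_insert n hST) h) (fun S T hST h => hB _ _ (insert_subset_insert n hST) h)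
        C' R hdis' hCR'
      have eL : (R.powerset.filter fun W => A (C ∪ W) ∧
            B (((C ∪ W).filter fun v => ((C ∪ W).filter fun w => w ≤ v).card ≤ s) ∪
              ((C ∪ (R \ W)).filter fun v => s ≤ ((C ∪ W).filter fun w => w < v).card))) =
          R.powerset.filter fun W => A (insert n (C' ∪ W)) ∧
            B (insert n (((C' ∪ W).filter fun v => ((C' ∪ W).filter fun w => w ≤ v).card ≤ s) ∪
              ((C' ∪ (R \ W)).filter fun v => s ≤ ((C' ∪ W).filter fun w => w < v).card))) := by
        apply filter_congr; intro W hW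
        rw [hC, insert_union, insert_union,
          splice_insert_both s (hsub W (mem_powerset.mp hW)) (hsub (R \ W) sdiff_subset)]
      have eR : (R.powerset.filter fun W => A (C ∪ W) ∧
            B (((C ∪ W).filter fun v => ((C ∪ W).filter fun w => w ≤ v).card ≤ s + 1) ∪
              ((C ∪ (R \ W)).filter fun v => s + 1 ≤ ((C ∪ W).filter fun w => w < v).card))) =
          R.powerset.filter fun W => A (insert n (C' ∪ W)) ∧
            B (insert n (((C' ∪ W).filter fun v => ((C' ∪ W).filter fun w => w ≤ v).card ≤ s + 1) ∪
              ((C' ∪ (R \ W)).filter fun v => s + 1 ≤ ((C' ∪ W).filter fun w => w < v).card))) := by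
        apply filter_congr; intro W hW
        rw [hC, insert_union, insert_union,
          splice_insert_both (s + 1) (hsub W (mem_powerset.mp hW)) (hsub (R \ W) sdiff_subset)]
      rw [eL, eR]
      exact IH
    · have hnC : n ∉ C := fun h => disjoint_left.mp hdis h hnR
      set R' := R.erase n with hR'_def
      have hR : R = insert n R' := by rw [hR'_def, insert_erase hnR]
      have hnR' : n ∉ R' := by rw [hR'_def]; exact notMem_erase n R
      have hdis' : Disjoint C R' := disjoint_of_subset_right (erase_subset n R) hdis
      have hCR' : C ∪ R' = V' := by
        have : (C ∪ R).erase n = (insert n V').erase n := by rw [hCR]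
        rwa [erase_insert hnV', hR, union_insert, erase_insert] at this
        rw [mem_union, not_or]; exact ⟨hnC, hnR'⟩
      have hsubx : ∀ W : Finset α, W ⊆ R' → ∀ w ∈ C ∪ W, w < n := fun W hW w hw => by
        apply hlt; rw [← hCR']; rcases mem_union.mp hw with h | h
        · exact mem_union_left _ h
        · exact mem_union_right _ (hW h)
      have IH01 := ih A (fun S => B (insert n S)) hA (fun S T hST h => hB _ _ (insert_subset_insert n hST) h) C R' hdis' hCR'
      have IH10 := ih (fun S => A (insert n S)) B (fun S T hST h => hA _ _ (insert_subset_insert n hST) h) hB C R' hdis' hCR'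
      rw [hR, powerset_insert]
      have hdisj : Disjoint R'.powerset (R'.powerset.image (insert n)) := by
        rw [disjoint_left]
        intro W hW hW'
        rw [mem_image] at hW'
        obtain ⟨W', _, rfl⟩ := hW'
        exact hnR' (mem_powerset.mp hW (mem_insert_self n W'))
      rw [filter_union, filter_union, card_union_of_disjoint (disjoint_filter_filter hdisj),
        card_union_of_disjoint (disjoint_filter_filter hdisj)]
      have hinj : Set.InjOn (insert n) (R'.powerset : Set (Finset α)) := by
        intro W₁ hW₁ W₂ hW₂ h
        have h1 : n ∉ W₁ := fun hh => hnR' (mem_powerset.mp (mem_coe.mp hW₁) hh)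
        have h2 : n ∉ W₂ := fun hh => hnR' (mem_powerset.mp (mem_coe.mp hW₂) hh)
        rw [← erase_insert h1, ← erase_insert h2, h]
      -- the four pieces, for level s (L) and level s+1 (R)
      have p0L : (R'.powerset.filter fun W => A (C ∪ W) ∧
            B (((C ∪ W).filter fun v => ((C ∪ W).filter fun w => w ≤ v).card ≤ s) ∪
              ((C ∪ (insert n R' \ W)).filter fun v => s ≤ ((C ∪ W).filter fun w => w < v).card))) =
          R'.powerset.filter fun W => A (C ∪ W) ∧
            B (if s ≤ (C ∪ W).card then
                insert n (((C ∪ W).filter fun v => ((C ∪ W).filter fun w => w ≤ v).card ≤ s) ∪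
                  ((C ∪ (R' \ W)).filter fun v => s ≤ ((C ∪ W).filter fun w => w < v).card))
               else (((C ∪ W).filter fun v => ((C ∪ W).filter fun w => w ≤ v).card ≤ s) ∪
                  ((C ∪ (R' \ W)).filter fun v => s ≤ ((C ∪ W).filter fun w => w < v).card))) := by
        apply filter_congr; intro W hW
        have hW' := mem_powerset.mp hW
        rw [insert_sdiff_of_notMem R' (fun h => hnR' (hW' h)), union_insert,
          splice_insert_right s (hsubx W hW') (hsubx (R' \ W) sdiff_subset)]
      have p0R : (R'.powerset.filter fun W => A (C ∪ W) ∧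
            B (((C ∪ W).filter fun v => ((C ∪ W).filter fun w => w ≤ v).card ≤ s + 1) ∪
              ((C ∪ (insert n R' \ W)).filter fun v => s + 1 ≤ ((C ∪ W).filter fun w => w < v).card))) =
          R'.powerset.filter fun W => A (C ∪ W) ∧
            B (if s + 1 ≤ (C ∪ W).card then
                insert n (((C ∪ W).filter fun v => ((C ∪ W).filter fun w => w ≤ v).card ≤ s + 1) ∪
                  ((C ∪ (R' \ W)).filter fun v => s + 1 ≤ ((C ∪ W).filter fun w => w < v).card))
               else (((C ∪ W).filter fun v => ((C ∪ W).filter fun w => w ≤ v).card ≤ s + 1) ∪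
                  ((C ∪ (R' \ W)).filter fun v => s + 1 ≤ ((C ∪ W).filter fun w => w < v).card))) := by
        apply filter_congr; intro W hW
        have hW' := mem_powerset.mp hW
        rw [insert_sdiff_of_notMem R' (fun h => hnR' (hW' h)), union_insert,
          splice_insert_right (s + 1) (hsubx W hW') (hsubx (R' \ W) sdiff_subset)]
      have p1L : ((R'.powerset.image (insert n)).filter fun W => A (C ∪ W) ∧
            B (((C ∪ W).filter fun v => ((C ∪ W).filter fun w => w ≤ v).card ≤ s) ∪
              ((C ∪ (insert n R' \ W)).filter fun v => s ≤ ((C ∪ W).filter fun w => w < v).card))).card =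
          (R'.powerset.filter fun W => A (insert n (C ∪ W)) ∧
            B (if (C ∪ W).card + 1 ≤ s then
                insert n (((C ∪ W).filter fun v => ((C ∪ W).filter fun w => w ≤ v).card ≤ s) ∪
                  ((C ∪ (R' \ W)).filter fun v => s ≤ ((C ∪ W).filter fun w => w < v).card))
               else (((C ∪ W).filter fun v => ((C ∪ W).filter fun w => w ≤ v).card ≤ s) ∪
                  ((C ∪ (R' \ W)).filter fun v => s ≤ ((C ∪ W).filter fun w => w < v).card)))).card := by
        rw [filter_image, card_image_of_injOn (fun x hx y hy h => hinj (mem_coe.mpr (mem_filter.mp (mem_coe.mp hx)).1)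
          (mem_coe.mpr (mem_filter.mp (mem_coe.mp hy)).1) h)]
        congr 1
        apply filter_congr; intro W hW
        have hW' := mem_powerset.mp hW
        rw [insert_sdiff_insert, sdiff_insert_of_notMem hnR', union_insert,
          splice_insert_left s (hsubx W hW') (hsubx (R' \ W) sdiff_subset)]
      have p1R : ((R'.powerset.image (insert n)).filter fun W => A (C ∪ W) ∧
            B (((C ∪ W).filter fun v => ((C ∪ W).filter fun w => w ≤ v).card ≤ s + 1) ∪
              ((C ∪ (insert n R' \ W)).filter fun v => s + 1 ≤ ((C ∪ W).filter fun w => w < v).card))).card =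
          (R'.powerset.filter fun W => A (insert n (C ∪ W)) ∧
            B (if (C ∪ W).card + 1 ≤ s + 1 then
                insert n (((C ∪ W).filter fun v => ((C ∪ W).filter fun w => w ≤ v).card ≤ s + 1) ∪
                  ((C ∪ (R' \ W)).filter fun v => s + 1 ≤ ((C ∪ W).filter fun w => w < v).card))
               else (((C ∪ W).filter fun v => ((C ∪ W).filter fun w => w ≤ v).card ≤ s + 1) ∪
                  ((C ∪ (R' \ W)).filter fun v => s + 1 ≤ ((C ∪ W).filter fun w => w < v).card)))).card := by
        rw [filter_image, card_image_of_injOn (fun x hx y hy h => hinj (mem_coe.mpr (mem_filter.mp (mem_coe.mp hx)).1)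
          (mem_coe.mpr (mem_filter.mp (mem_coe.mp hy)).1) h)]
        congr 1
        apply filter_congr; intro W hW
        have hW' := mem_powerset.mp hW
        rw [insert_sdiff_insert, sdiff_insert_of_notMem hnR', union_insert,
          splice_insert_left (s + 1) (hsubx W hW') (hsubx (R' \ W) sdiff_subset)]
      rw [p0L, p0R, p1L, p1R]
      -- pointwise: (L0+L1) + (IH right sides) ≤ (R0+R1) + (IH left sides); then add the two IH inequalities
      rw [card_filter, card_filter] at IH01 IH10
      rw [card_filter, card_filter, card_filter, card_filter]
      have key : ∀ W ∈ R'.powerset,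
          ((if A (C ∪ W) ∧ B (if s ≤ (C ∪ W).card then
                insert n (((C ∪ W).filter fun v => ((C ∪ W).filter fun w => w ≤ v).card ≤ s) ∪
                  ((C ∪ (R' \ W)).filter fun v => s ≤ ((C ∪ W).filter fun w => w < v).card))
               else (((C ∪ W).filter fun v => ((C ∪ W).filter fun w => w ≤ v).card ≤ s) ∪
                  ((C ∪ (R' \ W)).filter fun v => s ≤ ((C ∪ W).filter fun w => w < v).card))) then 1 else 0) +
           (if A (insert n (C ∪ W)) ∧ B (if (C ∪ W).card + 1 ≤ s then
                insert n (((C ∪ W).filter fun v => ((C ∪ W).filter fun w => w ≤ v).card ≤ s) ∪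
                  ((C ∪ (R' \ W)).filter fun v => s ≤ ((C ∪ W).filter fun w => w < v).card))
               else (((C ∪ W).filter fun v => ((C ∪ W).filter fun w => w ≤ v).card ≤ s) ∪
                  ((C ∪ (R' \ W)).filter fun v => s ≤ ((C ∪ W).filter fun w => w < v).card))) then 1 else 0)) +
          ((if A (C ∪ W) ∧ B (insert n (((C ∪ W).filter fun v => ((C ∪ W).filter fun w => w ≤ v).card ≤ s + 1) ∪
                  ((C ∪ (R' \ W)).filter fun v => s + 1 ≤ ((C ∪ W).filter fun w => w < v).card))) then 1 else 0) +
           (if A (insert n (C ∪ W)) ∧ B (((C ∪ W).filter fun v => ((C ∪ W).filter fun w => w ≤ v).card ≤ s + 1) ∪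
                  ((C ∪ (R' \ W)).filter fun v => s + 1 ≤ ((C ∪ W).filter fun w => w < v).card)) then 1 else 0)) ≤
          ((if A (C ∪ W) ∧ B (if s + 1 ≤ (C ∪ W).card then
                insert n (((C ∪ W).filter fun v => ((C ∪ W).filter fun w => w ≤ v).card ≤ s + 1) ∪
                  ((C ∪ (R' \ W)).filter fun v => s + 1 ≤ ((C ∪ W).filter fun w => w < v).card))
               else (((C ∪ W).filter fun v => ((C ∪ W).filter fun w => w ≤ v).card ≤ s + 1) ∪
                  ((C ∪ (R' \ W)).filter fun v => s + 1 ≤ ((C ∪ W).filter fun w => w < v).card))) then 1 else 0) +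
           (if A (insert n (C ∪ W)) ∧ B (if (C ∪ W).card + 1 ≤ s + 1 then
                insert n (((C ∪ W).filter fun v => ((C ∪ W).filter fun w => w ≤ v).card ≤ s + 1) ∪
                  ((C ∪ (R' \ W)).filter fun v => s + 1 ≤ ((C ∪ W).filter fun w => w < v).card))
               else (((C ∪ W).filter fun v => ((C ∪ W).filter fun w => w ≤ v).card ≤ s + 1) ∪
                  ((C ∪ (R' \ W)).filter fun v => s + 1 ≤ ((C ∪ W).filter fun w => w < v).card))) then 1 else 0)) +
          ((if A (C ∪ W) ∧ B (insert n (((C ∪ W).filter fun v => ((C ∪ W).filter fun w => w ≤ v).card ≤ s) ∪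
                  ((C ∪ (R' \ W)).filter fun v => s ≤ ((C ∪ W).filter fun w => w < v).card))) then 1 else 0) +
           (if A (insert n (C ∪ W)) ∧ B (((C ∪ W).filter fun v => ((C ∪ W).filter fun w => w ≤ v).card ≤ s) ∪
                  ((C ∪ (R' \ W)).filter fun v => s ≤ ((C ∪ W).filter fun w => w < v).card)) then 1 else 0)) := by
        intro W hW
        have ha : A (C ∪ W) → A (insert n (C ∪ W)) := hA _ _ (subset_insert n _)
        rcases Nat.lt_trichotomy (C ∪ W).card s with hlt' | heq | hgt
        · -- below level s: both splices are x' itself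
          have h1 : ¬ (s ≤ (C ∪ W).card) := by omega
          have h2 : (C ∪ W).card + 1 ≤ s := by omega
          have h3 : ¬ (s + 1 ≤ (C ∪ W).card) := by omega
          have h4 : (C ∪ W).card + 1 ≤ s + 1 := by omega
          rw [if_neg h1, if_pos h2, if_neg h3, if_pos h4,
            splice_eq_self_of_card_lt s hlt', splice_eq_self_of_card_lt (s + 1) (by omega)]
        · -- exactly level s: the remainder (a₁ − a₀)(b₁ − b₀) at Q = ψ̃_{s+1}
          have h1 : s ≤ (C ∪ W).card := by omega
          have h2 : ¬ ((C ∪ W).card + 1 ≤ s) := by omega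
          have h3 : ¬ (s + 1 ≤ (C ∪ W).card) := by omega
          have h4 : (C ∪ W).card + 1 ≤ s + 1 := by omega
          rw [if_pos h1, if_neg h2, if_neg h3, if_pos h4]
          have hx := ite_cross_le (A (C ∪ W)) (A (insert n (C ∪ W)))
            (B (((C ∪ W).filter fun v => ((C ∪ W).filter fun w => w ≤ v).card ≤ s + 1) ∪
                  ((C ∪ (R' \ W)).filter fun v => s + 1 ≤ ((C ∪ W).filter fun w => w < v).card)))
            (B (insert n (((C ∪ W).filter fun v => ((C ∪ W).filter fun w => w ≤ v).card ≤ s + 1) ∪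
                  ((C ∪ (R' \ W)).filter fun v => s + 1 ≤ ((C ∪ W).filter fun w => w < v).card))))
            ha (hB _ _ (subset_insert n _))
          omega
        · -- above level s: everything matches the IH pieces
          have h1 : s ≤ (C ∪ W).card := by omega
          have h2 : ¬ ((C ∪ W).card + 1 ≤ s) := by omega
          have h3 : s + 1 ≤ (C ∪ W).card := by omega
          have h4 : ¬ ((C ∪ W).card + 1 ≤ s + 1) := by omega
          rw [if_pos h1, if_neg h2, if_pos h3, if_neg h4]
          omega
      have hsum := sum_le_sum key
      rw [sum_add_distrib, sum_add_distrib, sum_add_distrib, sum_add_distrib, sum_add_distrib, sum_add_distrib] at hsum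
      omega

/-- The splice chain for up-set families: `#{W ⊆ R : x ∈ 𝒜, ψ̃_s(x,y) ∈ ℬ} ≤ #{W ⊆ R : x ∈ 𝒜, ψ̃_{s+1}(x,y) ∈ ℬ}`. [this work] -/
theorem card_splice_mem_le_card_splice_succ_mem (s : ℕ) (𝒜 ℬ : Finset (Finset α))
    (h𝒜 : IsUpperSet (𝒜 : Set (Finset α))) (hℬ : IsUpperSet (ℬ : Set (Finset α))) (C R : Finset α) (hCR : Disjoint C R) :
    (R.powerset.filter fun W => C ∪ W ∈ 𝒜 ∧
      (((C ∪ W).filter fun v => ((C ∪ W).filter fun w => w ≤ v).card ≤ s) ∪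
        ((C ∪ (R \ W)).filter fun v => s ≤ ((C ∪ W).filter fun w => w < v).card)) ∈ ℬ).card ≤
    (R.powerset.filter fun W => C ∪ W ∈ 𝒜 ∧
      (((C ∪ W).filter fun v => ((C ∪ W).filter fun w => w ≤ v).card ≤ s + 1) ∪
        ((C ∪ (R \ W)).filter fun v => s + 1 ≤ ((C ∪ W).filter fun w => w < v).card)) ∈ ℬ).card :=
  card_splice_le_card_splice_succ s (C ∪ R) (fun S => S ∈ 𝒜) (fun S => S ∈ ℬ)
    (fun S T hST h => h𝒜 (show S ≤ T from hST) h) (fun S T hST h => hℬ (show S ≤ T from hST) h) C R hCR rfl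

end SahiCTCStrongTwistedKleitman

end Summit.CriticalPhenomena.PercolationContinuityZ3.Theorems
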